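import Summits.QuantumFields.BalabanUV.Beta.GAN24.RowD1LiteralOfTowerEnd
import Literature.MathematicalPhysics.QuantumFieldTheory.Balaban1983to89.Beta.HessKerDressedCauchy
import Summits.QuantumFields.BalabanUV.Beta.RowD1TelescopingBounded
import Summits.QuantumFields.BalabanUV.Beta.FixedPointIdentification

/-!
# `BalabanUV.Beta.GAN24.TowerEndRowD1Sockets` — binder row G-an2-4 ∕ (CONV-C), W-slot (α-0): **THE END OF THE TOWER PLUGGED INTO THE D1-SIDE SOCKETS OF
# ROAD A2 (convergence form), ROAD FP (rate binder) AND THE TELESCOPING ROW («two out of three»), plus the END-grade `EndpointExistence` reading, FOR THE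
# LITERAL `JsRowD1Pin hLc N`** — the part of the consumer junction NOT covered by its two siblings of the hour: gan24-leaf-01 g78's `GAN24/RowD1LiteralOfTowerEnd`
# (p396794: the END at the pins, `tendsto`, `GeomRate` about the constructed limit, `D1Drift ↔ lim = stepBal`, `↔` Cesàro, road BF-x's three MEAN ENDs slot-free) and
# road-P2 g54's `GAN24/WrecAtEvenHalfRowsOfTowerEndMean` (J-54 v2: road BF-x's four `_of_prop12` ∕ sbp ∕ «ENDₛ» MEAN debt ENDs slot-free).  NO statement of either sibling is re-declared here;
# the END's letter is taken BY NAME from its ONE supplier of record at (E), the first sibling's §1 `RowD1LiteralOfTowerEnd.exists_allScalesSeq_JsRowD1Pin`.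
# (OWNER `b2b-balaban-gan24-p1`, gen 45; journal [GAN24P1-G45-INTENT-1] ∕ A-1; the junction road-P2 g53 asked the OWNER to name, [GAN24P2-G53-CLOSE])

HONEST DEPENDENCY (page 1, mandatory): continuum YM on T⁴ ⇐ BetaPertH ∧ nine spine estimates (0/9 proved); BetaPertH ⇐ (D1) ∧ (D4) ∧
CAP+tail; G-an2-4 gates asym, D1 and NE2/3/4.  HONEST FRAMING (cell contract, verbatim): «discharging `BetaPertH` makes Bałaban's UV
stability UNCONDITIONAL — a real constructive-QFT result; it is NOT the continuum limit and NOT the Clay problem.»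
ABSOLUTE RULE (cell charter, verbatim): «No internally-minted statement may enter as a cited fact. Every hypothesis is either kernel-proved in
this package or a verbatim quotation of a PUBLISHED theorem with page reference. The manuscript(s) under audit are NOT citable for their own
disputed steps — they are the thing under adjudication; programme-internal (2001/route/tribunal) claims are never citable.»
NOTHING below is cited; no `def`, no `def … : Prop`, 0 sorry.  [folklore] composition BY NAME of tree theorems.

WHY.  Road-P2's END `WrecAtEvenHalfRowsOfTowerEnd.exists_allScalesSeq_JsRowD1Pin` (p396101 ✓; statement = the OWNER's `end_of_tower₅`) is, at the pins
`r = ctrOff 4 Lc`, `(cE, cVH, cΛ, cE₂, cB) = (Lc⁴, −Lc⁸∕2, 2∕Lc⁴, Lc⁸, −Lc¹²∕4)`, `vh₂S = vh₂SAn1 Lc` (all fed by `rfl` in the first sibling's §1), the HYPOTHESIS-FREE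
all-scales letter `∃ κ θ, 0 ≤ θ < 1 ∧ AllScalesSeq (j ↦ β⁰_j) κ θ`, `β⁰_j := secondMoment (TbalOf Lc (JsRowD1Pin hLc N) j) μ ν`, for an2's chart-(II) rooted
literal at the locks (X-an2-51, family (E); NOT row D1's literal of record (III′)∕(III″), an2 W-4 l.64553).  Besides road BF-x's MEAN sockets (the siblings), three
D1-side shapes of record consume exactly such a letter: road A2's wall socket `HessKerDressedCauchy.d1Drift_iff_lim_eq` (here in its CONVERGENCE and DRIFT forms),
road FP's route theorem `FixedPointIdentification.oneLoopDrift_stepBal_of_rate_step_law_*` (binder `hrate : GeomRate β⁰ (f Lc) c₀ θ`), and an2's «two out of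
three» `RowD1ThreeRoads` ∕ `RowD1TelescopingBounded` (there GIVEN road A2's four L2 half-kernel letters `hWu hWa hSu hSa`).  This file feeds the END into each
BY NAME; what remains displayed is ROW D1's OWN clause and nothing of row G-an2-4's.

CONTENT (`d + 1 = 4`; odd `Lc ≥ 2` and `N ≥ 2` — the END's own hypotheses (the Wilson normalisation `Tc = (8N²)⁻¹ • wsym22 N` of its crossed value ledger
needs `2 ≤ N`); `β⁰ := fun j ↦ secondMoment (TbalOf Lc (JsRowD1Pin hLc N) j) μ ν`; the colour parameter `Nc : ℝ` of `D1Drift` FREE against the `SU(N)` of `Tc`,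
as in every D1-side END of record).
* §1 two letters of the literal not in the siblings: `exists_geomRate_of_tendsto` (two-ended rate `GeomRate β⁰ a κ θ` about ANY limit value `a` GIVEN only the
  dictionary clause `β⁰_j → a` — road FP's `hrate` binder shape) and `exists_oneLoopDrift_lim` (`∃ A, OneLoopDrift (CauchyRate.lim β⁰) A β⁰`: the coefficients
  of the literal DO drift, with slope their limit — so `D1Drift` for the literal is EXACTLY a value statement).
* §2 road A2's socket in CONVERGENCE form, letter-free: `d1Drift_iff_tendsto_stepBal` (`D1Drift Lc (JsRowD1Pin hLc N) Nc μ ν ↔ β⁰_j → stepBal Nc Lc`; from the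
  sibling's `↔ CauchyRate.lim β⁰ = stepBal Nc Lc` form `RowD1LiteralOfTowerEnd.d1Drift_JsRowD1Pin_iff_lim_eq` and its `tendsto_secondMoment_JsRowD1Pin`, BY NAME).
* §3 road FP's route theorem, RATE-FREE: `d1Drift_of_step_law_bounded` ∕ `_littleO` — the dictionary clause `β⁰_j → f Lc`, the step law of `f` on the powers
  of `Lc` and the leading-log asymptotics (bounded ∕ `o(m)`) give `D1Drift` (`hrate ⟸ AllScalesSeq.geomRate_of_tendsto`).
* §4 an2's «two out of three» WITHOUT road A2's letters: `sdSumBdd_iff_lim_eq_of_D1Rep` — GIVEN `D1Rep (JcPin hLc N)` and the free-bubble standing data,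
  (SDF-Σ) ⟺ `CauchyRate.lim β⁰ = stepBal Nc Lc` (`RowD1TelescopingBounded.sdSumBdd_iff_D1Drift_of_D1Rep` ⨾ `RowD1LiteralOfTowerEnd.d1Drift_JsRowD1Pin_iff_lim_eq`).
* §5 END grade: `endpointExistence_of_lim_eq` — `CauchyRate.lim β⁰ = stepBal Nc Lc` ∧ `hβ` ∧ (D4) ∧ (C) ⟹ `EndpointExistence`
  (`OneStepKernelFamily.endpointExistence_of_D1Drift` ⨾ the same).
WHAT IT IS NOT.  It asserts NO value of Bałaban's tables; it does NOT prove `CauchyRate.lim β⁰ = stepBal Nc Lc` or `β⁰_j → stepBal Nc Lc` (that identification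
IS binder row D1 — an2's roads: the step law + asymptotics (FP), (B1_mean) ∧ (T_mean) (BF-x), `D1Rep` ∧ (SDF-Σ) (telescoping)); `JsRowD1Pin` is OUR typed family,
its identification with Bałaban's `G_k ∕ H_k` data is an2's; NEVER «G-an2-4 closed» as (CONV-C); NOT D1, NOT `BetaPertH`, NOT continuum, NOT Clay.  2026-08-25.
-/
noncomputable section

open Finset Filter Topology
open scoped BigOperators
open Literature.MathematicalPhysics.QuantumFieldTheory
open Literature.MathematicalPhysics.QuantumFieldTheory.Balaban1983to89
open Literature.MathematicalPhysics.QuantumFieldTheory.Balaban1983to89.Beta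
open FlowStep (HBeta BetaContH)
open DagBinding (EndpointExistence ForwardGenerated)
open RemainderConstAllScales (AllScalesSeq)
open RateCertificate (GeomRate CauchyRate)
open Drift (OneLoopDrift)
open B12Beta (secondMoment)
open B12Normalization (stepBal)
open OneStepKernelFamily (TbalOf D1Rep D1Drift endpointExistence_of_D1Drift)
open StepDriftWitness (SD)
open Literature.MathematicalPhysics.QuantumFieldTheory.Balaban1983to89.Beta.RemainderChain (RemainderConst)
open Literature.MathematicalPhysics.QuantumFieldTheory.Balaban1983to89.Beta.VectorTailsLoc (fam kfam)
open Literature.MathematicalPhysics.QuantumFieldTheory.Balaban1983to89.Beta.VectorLegVolumeAdapter (MvE)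
open Summit.QuantumFields.BalabanUV.Beta.RowD1JointEnd (JsRowD1Pin)
open Summit.QuantumFields.BalabanUV.Beta.D1BFx.FirstStepPinned (JcPin)
open Summit.QuantumFields.BalabanUV.Beta.GAN24.RowD1LiteralOfTowerEnd (exists_allScalesSeq_JsRowD1Pin tendsto_secondMoment_JsRowD1Pin
  d1Drift_JsRowD1Pin_iff_lim_eq)
open Summit.QuantumFields.BalabanUV.Beta.RowD1TelescopingBounded (sdSumBdd_iff_D1Drift_of_D1Rep)
open Summit.QuantumFields.BalabanUV.Beta.FixedPointIdentification (oneLoopDrift_stepBal_of_rate_step_law_bounded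
  oneLoopDrift_stepBal_of_rate_step_law_littleO)

namespace Summit.QuantumFields.BalabanUV.Beta.GAN24.TowerEndRowD1Sockets

variable {Lc : ℕ} [NeZero Lc]

/-! ## §1 Two letters of the literal of record (the END's letter BY NAME from `RowD1LiteralOfTowerEnd` §1) -/

/-- [folklore] **TWO-ENDED GEOMETRIC RATE ABOUT ANY LIMIT VALUE**: if `β⁰_j → a` then `∃ κ θ, 0 ≤ θ < 1 ∧ GeomRate β⁰ a κ θ`
(`AllScalesSeq.geomRate_of_tendsto`) — road FP's `hrate` binder for the literal, GIVEN only the dictionary clause `β⁰_j → a`. -/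
theorem exists_geomRate_of_tendsto (hLc : Odd Lc) (hL2 : 2 ≤ Lc) {N : ℕ} (hN : 2 ≤ N) (μ ν : Fin 4) {a : ℝ}
    (ha : Tendsto (fun j => secondMoment (TbalOf Lc (JsRowD1Pin hLc N) j) μ ν) atTop (𝓝 a)) :
    ∃ κ θ : ℝ, 0 ≤ θ ∧ θ < 1 ∧ GeomRate (fun j => secondMoment (TbalOf Lc (JsRowD1Pin hLc N) j) μ ν) a κ θ := by
  obtain ⟨κ, θ, hθ0, hθ1, hall⟩ := exists_allScalesSeq_JsRowD1Pin hLc hL2 hN μ ν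
  exact ⟨κ, θ, hθ0, hθ1, hall.geomRate_of_tendsto ha⟩

/-- [folklore] **THE COEFFICIENTS OF THE LITERAL DRIFT WITH SLOPE THEIR LIMIT**: `∃ A, OneLoopDrift (CauchyRate.lim β⁰) A β⁰`
(`HessKerDressedCauchy.oneLoopDrift_lim`, `A = κ∕(1−θ)`) — so `D1Drift` for the literal is EXACTLY a value statement (`↔ lim β⁰ = stepBal Nc Lc`, the sibling's
`RowD1LiteralOfTowerEnd.d1Drift_JsRowD1Pin_iff_lim_eq`; `↔ β⁰_j → stepBal Nc Lc`, §2 below). -/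
theorem exists_oneLoopDrift_lim (hLc : Odd Lc) (hL2 : 2 ≤ Lc) {N : ℕ} (hN : 2 ≤ N) (μ ν : Fin 4) :
    ∃ A : ℝ, OneLoopDrift (CauchyRate.lim fun j => secondMoment (TbalOf Lc (JsRowD1Pin hLc N) j) μ ν) A
      (fun j => secondMoment (TbalOf Lc (JsRowD1Pin hLc N) j) μ ν) := by
  obtain ⟨κ, θ, hθ0, hθ1, hall⟩ := exists_allScalesSeq_JsRowD1Pin hLc hL2 hN μ ν
  exact ⟨_, HessKerDressedCauchy.oneLoopDrift_lim hall hθ0 hθ1⟩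

/-! ## §2 Road A2's wall socket for the literal of record in CONVERGENCE form, with NO half-kernel letter -/

/-- [folklore] **THE WALL ⟺ CONVERGENCE OF THE COEFFICIENTS TO `stepBal Nc Lc`, LETTER-FREE.**  For odd `Lc ≥ 2`, `N ≥ 2`, every channel and every colour
parameter `Nc`: `D1Drift Lc (JsRowD1Pin hLc N) Nc μ ν ↔ β⁰_j → stepBal Nc Lc` (the sibling's `RowD1LiteralOfTowerEnd.d1Drift_JsRowD1Pin_iff_lim_eq` and
`tendsto_secondMoment_JsRowD1Pin` BY NAME + uniqueness of limits).  Compare `RowD1ThreeRoads.d1Drift_JsRowD1Pin_iff_ident` (four L2 letters `hWu hWa hSu hSa` displayed, the limit named by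
two limit half-kernels): here NO letter is displayed.  The right side is NOT proved. -/
theorem d1Drift_iff_tendsto_stepBal (hLc : Odd Lc) (hL2 : 2 ≤ Lc) {N : ℕ} (hN : 2 ≤ N) (μ ν : Fin 4) (Nc : ℝ) :
    D1Drift Lc (JsRowD1Pin hLc N) Nc μ ν ↔
      Tendsto (fun j => secondMoment (TbalOf Lc (JsRowD1Pin hLc N) j) μ ν) atTop (𝓝 (stepBal Nc Lc)) := by
  rw [d1Drift_JsRowD1Pin_iff_lim_eq hLc hL2 hN μ ν Nc]
  exact ⟨fun h => h ▸ tendsto_secondMoment_JsRowD1Pin hLc hL2 hN μ ν,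
    fun h => tendsto_nhds_unique (tendsto_secondMoment_JsRowD1Pin hLc hL2 hN μ ν) h⟩

/-! ## §3 Road FP's route theorem for the literal of record, RATE-FREE -/

/-- **ROAD «FP» FOR THE LITERAL OF RECORD, `hrate` DISCHARGED (bounded-defect form)** [folklore composition].  IF the one-loop coefficients of the literal
converge to the `Lc`-member `f Lc` of a family `f` (the DICTIONARY clause — road FP reads `f n` as the second moment of the perfect step with blocking factor
`n`; NOT proved here), AND `f` obeys the step law on the powers of `Lc`, AND `|f (Lc^m) − stepBal Nc (Lc^m)| ≤ C` for `m ≥ 1`, THEN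
`D1Drift Lc (JsRowD1Pin hLc N) Nc μ ν` — `FixedPointIdentification.oneLoopDrift_stepBal_of_rate_step_law_bounded` with `hrate ⟸` the END (`AllScalesSeq.geomRate_of_tendsto`).
The three displayed clauses are row D1's; this theorem discharges only row G-an2-4's rate binder. -/
theorem d1Drift_of_step_law_bounded (hLc : Odd Lc) (hL2 : 2 ≤ Lc) {N : ℕ} (hN : 2 ≤ N) {μ ν : Fin 4} {Nc : ℝ} {f : ℕ → ℝ} {C : ℝ}
    (hlim : Tendsto (fun j => secondMoment (TbalOf Lc (JsRowD1Pin hLc N) j) μ ν) atTop (𝓝 (f Lc)))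
    (hstep : ∀ m : ℕ, 1 ≤ m → f (Lc ^ (m + 1)) = f (Lc ^ m) + f Lc)
    (hasym : ∀ m : ℕ, 1 ≤ m → |f (Lc ^ m) - stepBal Nc ((Lc : ℝ) ^ m)| ≤ C) :
    D1Drift Lc (JsRowD1Pin hLc N) Nc μ ν := by
  obtain ⟨κ, θ, hθ0, hθ1, hall⟩ := exists_allScalesSeq_JsRowD1Pin hLc hL2 hN μ ν
  exact ⟨_, oneLoopDrift_stepBal_of_rate_step_law_bounded (hall.geomRate_of_tendsto hlim) hθ0 hθ1 hstep hasym⟩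

/-- **ROAD «FP» FOR THE LITERAL OF RECORD, `hrate` DISCHARGED (mean-law form)**: as above with the asymptotic input weakened to `o(m)`. -/
theorem d1Drift_of_step_law_littleO (hLc : Odd Lc) (hL2 : 2 ≤ Lc) {N : ℕ} (hN : 2 ≤ N) {μ ν : Fin 4} {Nc : ℝ} {f : ℕ → ℝ}
    (hlim : Tendsto (fun j => secondMoment (TbalOf Lc (JsRowD1Pin hLc N) j) μ ν) atTop (𝓝 (f Lc)))
    (hstep : ∀ m : ℕ, 1 ≤ m → f (Lc ^ (m + 1)) = f (Lc ^ m) + f Lc)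
    (hasym : Tendsto (fun m : ℕ => (f (Lc ^ m) - stepBal Nc ((Lc : ℝ) ^ m)) / (m : ℝ)) atTop (𝓝 0)) :
    D1Drift Lc (JsRowD1Pin hLc N) Nc μ ν := by
  obtain ⟨κ, θ, hθ0, hθ1, hall⟩ := exists_allScalesSeq_JsRowD1Pin hLc hL2 hN μ ν
  exact ⟨_, oneLoopDrift_stepBal_of_rate_step_law_littleO (hall.geomRate_of_tendsto hlim) hθ0 hθ1 hstep hasym⟩

/-! ## §4 an2's «two out of three» for the literal of record WITHOUT road A2's letters -/

/-- [folklore] **GIVEN `D1Rep (JcPin hLc N)`, (SDF-Σ) ⟺ THE SCALAR IDENTIFICATION `CauchyRate.lim β⁰ = stepBal Nc Lc`** — an2's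
`RowD1TelescopingBounded.sdSumBdd_iff_D1Drift_of_D1Rep` (standing data: the printed B5 Props BY NAME, labels, channel `μ ≠ ν`, colour `Nc ≠ 0`, window) composed
with the sibling's `RowD1LiteralOfTowerEnd.d1Drift_JsRowD1Pin_iff_lim_eq` BY NAME; compare `RowD1ThreeRoads.sdSumBdd_iff_ident_of_D1Rep` (the same «two out of three» GIVEN
road A2's four L2 half-kernel letters — here NONE is displayed).
Neither side is proved; `D1Rep` (EXIT-A) is row D1's. -/
theorem sdSumBdd_iff_lim_eq_of_D1Rep {L : Type*} (hLc : Odd Lc) (hL2 : 2 ≤ Lc) {N : ℕ} (hN : 2 ≤ N)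
    (a : ℝ) (ha : 0 < a)
    (h12 : B5.Prop12Printed (fam (fun i : ℕ+ × ℕ => ((i.1 : ℕ+) : ℕ)) (fun i => i.1.pos) MvE a ha))
    (h126 : B5.Kernel126_127Printed (kfam (fun i : ℕ+ × ℕ => ((i.1 : ℕ+) : ℕ)) MvE))
    {SL : Finset L} (hSL : SL.Nonempty) (k : L → Fin 4) {μ ν : Fin 4} (hμν : μ ≠ ν) {Nc : ℝ} (hNc : Nc ≠ 0)
    {cc : ℝ} {M : ℕ → ℕ} (hc : 1 ≤ cc) (hMw : ∀ L : ℕ, 2 ≤ L → 1 ≤ M L ∧ (L : ℝ) ≤ cc * M L) (hML : ∀ L : ℕ, 2 ≤ L → M L ≤ L)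
    (hrep : D1Rep Lc (JcPin hLc N) Nc μ ν a SL k) :
    (∃ U' : ℝ, ∀ m : ℕ, 1 ≤ m → |∑ j ∈ Ico 1 m, secondMoment (SD Lc (JsRowD1Pin hLc N) (JcPin hLc N) j) μ ν| ≤ U') ↔
      CauchyRate.lim (fun j => secondMoment (TbalOf Lc (JsRowD1Pin hLc N) j) μ ν) = stepBal Nc Lc :=
  (sdSumBdd_iff_D1Drift_of_D1Rep hLc hL2 hN a ha h12 h126 hSL k hμν hNc hc hMw hML hrep).trans
    (d1Drift_JsRowD1Pin_iff_lim_eq hLc hL2 hN μ ν Nc)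

/-! ## §5 END grade: the scalar identification + `hβ` + (D4) + (C) ⟹ `EndpointExistence` -/

/-- [folklore] **THE END FROM THE SCALAR IDENTIFICATION**: IF `CauchyRate.lim β⁰ = stepBal Nc Lc` (row D1's identification for the literal — NOT proved),
`Sβ.β0 j = β⁰_j` (an2's dictionary `hβ`), the printed remainder constant (D4) with `rr ≤ stepBal Nc Lc`, and continuity (C), THEN `EndpointExistence Cn`
(`OneStepKernelFamily.endpointExistence_of_D1Drift` ⨾ the sibling's `RowD1LiteralOfTowerEnd.d1Drift_JsRowD1Pin_iff_lim_eq` BY NAME).  Four displayed binders, none of row G-an2-4's. -/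
theorem endpointExistence_of_lim_eq (hLc : Odd Lc) (hL2 : 2 ≤ Lc) {N : ℕ} (hN : 2 ≤ N) {μ ν : Fin 4} {Nc : ℝ}
    (hI : CauchyRate.lim (fun j => secondMoment (TbalOf Lc (JsRowD1Pin hLc N) j) μ ν) = stepBal Nc Lc)
    {β : HBeta} {Cn : B12.Construction} (hgen : ForwardGenerated Cn β) (Sβ : B12Beta.OneLoopSplit β)
    (hβ : ∀ j, Sβ.β0 j = secondMoment (TbalOf Lc (JsRowD1Pin hLc N) j) μ ν)
    {rr γ₀ : ℝ} (hγ₀ : 0 < γ₀) (hrem : RemainderConst Sβ γ₀ rr) (hr : rr ≤ stepBal Nc Lc) (hcont : BetaContH γ₀ β) :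
    EndpointExistence Cn :=
  endpointExistence_of_D1Drift hgen Sβ (JsRowD1Pin hLc N) hβ ((d1Drift_JsRowD1Pin_iff_lim_eq hLc hL2 hN μ ν Nc).2 hI) hγ₀ hrem hr hcont

end Summit.QuantumFields.BalabanUV.Beta.GAN24.TowerEndRowD1Sockets

end
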